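import Summits.AtomisticToContinuum.Crystallization.Theorems.FrustratedLawDichotomyStrainedPatchHomWitnessSite

/-!
# An ADMISSIBLE homogeneous fcc-type ball from parametric certificates, and `(R)` from a floor number plus those certificates
# (27623 strained-patch piece; decomp-a2c, prover hand 2, generation 20 — the (R)-side twin of the (H) prune interface; fcc family)

`(R) TextureReliefBound L B ⟸` plain floor + ONE realised admissible homogeneous instance (`…HomRelief.textureReliefBound_of_floor_of_realised_fcc`).
This DEF-FREE module discharges the «realised admissible» part down to PARAMETRIC certificates about the deformed lattice `U·L_fcc`
(`‖U − 1‖ ≤ 1/4`), in the uniform shape «for every cluster site whose neighbourhood is `z j + T` (up to the stated radius), …»,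
which the site lemmas of `…HomWitnessSite` produce from data:

* §1 `exists_realisation_fcc`: the `133/10`-ball of `p + U·L_fcc` is finite (index box) and has an injective enumeration;
* §2 ★ `admissible_of_certificates_fcc`: `Admissible M z c` for EVERY injective enumeration of a `U`-fcc ball, from four cluster-free hypotheses
  on the displacement set `T = U·L_fcc`: (a) NOT `1/20`-good given homogeneity of radius `5/2` (members and reach sites: `63/10 + 5/2 ≤ 133/10`),
  (b) `1/8`-good given radius `15/2` (members: `9/5 + 15/2 ≤ 133/10`), (c) not removal-unstable and (d) not move-unstable (`∀ s ∈ [0, 3/2]`)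
  given CLOSED radius `7` (reach sites: `63/10 + 7 = 133/10`); `Sep` and the radius clause are automatic (`admissible_iff_of_fcc_range`);
* §3 ★★ `textureReliefBound_of_floor_of_certificates_fcc`: `(R)` from the floor number `X_fcc(U) − (L·σ₁ + B) ≤ ballAvg` on admissible clusters
  plus (a)–(d) — no cluster-valued witness left to exhibit.
(The reference of record, family A, is of hcp type: the hcp twin with `T_A`/`T_B = −T_A` and an A–B separation certificate is the sequel.)

0 sorry; no definitions; axioms ⊆ {propext, Classical.choice, Quot.sound}.  `--supports stmt-AtomisticToContinuum-27623`.
-/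

noncomputable section

namespace Summit.AtomisticToContinuum.Crystallization.Theorems.FrustratedLawDichotomyStrainedPatchHomWitness

open scoped BigOperators Classical
open Summit.AtomisticToContinuum.Crystallization.Theorems.ChargedEnergyGapNegative (E3)
open Summit.AtomisticToContinuum.Crystallization.Theorems.FrustratedLawDichotomySchurCut (effPot w₄₅ ω₄)
open Summit.AtomisticToContinuum.Crystallization.Theorems.FrustratedLawDichotomyMotifLemmas (GoodAtScale)
open Summit.AtomisticToContinuum.Crystallization.Theorems.FrustratedLawDichotomyAveragingCut (ball ballAvg mem_ball)
open Summit.AtomisticToContinuum.Crystallization.Theorems.FrustratedLawDichotomyExemptAbsorptionRecord (MoveUnstableCore RemovalUnstableCore)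
open Summit.AtomisticToContinuum.Crystallization.Theorems.FrustratedLawDichotomyCollarCensus (Collar)
open Summit.AtomisticToContinuum.Crystallization.Theorems.FrustratedLawDichotomyStrainedPatchHomSplit
open Summit.AtomisticToContinuum.Crystallization.Theorems.FrustratedLawDichotomyStrainedPatchHomRelief
open Summit.AtomisticToContinuum.Crystallization.Theorems.FrustratedLawDichotomyStrainedPatchHomLatticeBox
open Summit.AtomisticToContinuum.Crystallization.Theorems.FrustratedLawDichotomyStrainedPatchHomWitnessSite
open Literature.Barriers.AtomisticToContinuum.FlatleyTheil2015 (fccVec fccPoint)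

/-! ## §1. The deformed fcc ball is finite and has an injective enumeration -/

/-- The `133/10`-ball of `p + U·L_fcc` lies in the image of the label box `[−22, 22]³` (`‖U − 1‖ ≤ 1/4`). [folklore] -/
theorem fccBall_subset_image_box {U : E3 →L[ℝ] E3} (hU : ‖U - 1‖ ≤ 1 / 4) (p : E3) :
    {x : E3 | dist x p ≤ 133 / 10 ∧ ∃ a : Fin 3 → ℤ, x = p + latPt U fccVec a} ⊆
      (fun a : Fin 3 → ℤ => p + latPt U fccVec a) '' ↑(Fintype.piFinset fun _ : Fin 3 => Finset.Icc (-(22 : ℤ)) 22) := by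
  rintro x ⟨hx, a, rfl⟩
  refine ⟨a, ?_, rfl⟩
  have hn : ‖latPt U fccVec a‖ ≤ 133 / 10 := by simpa [dist_eq_norm] using hx
  have h34 := norm_apply_ge_of_near_one hU (fccPoint a)
  rw [← latPt_fccVec_eq] at h34
  have hfp : ‖fccPoint a‖ < 4 / 3 * (27 / 2) := by linarith
  exact_mod_cast mem_box_of_norm_fccPoint_lt (R := 27 / 2) (K := 22) (by norm_num) hfp

/-- The `133/10`-ball of `p + U·L_fcc` is finite. [folklore] -/
theorem fccBall_finite {U : E3 →L[ℝ] E3} (hU : ‖U - 1‖ ≤ 1 / 4) (p : E3) :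
    {x : E3 | dist x p ≤ 133 / 10 ∧ ∃ a : Fin 3 → ℤ, x = p + latPt U fccVec a}.Finite :=
  ((Finset.finite_toSet _).image _).subset (fccBall_subset_image_box hU p)

/-- ★ **Every deformed fcc ball is REALISED by an injective enumeration** centred at any point `p`. [folklore] -/
theorem exists_realisation_fcc {U : E3 →L[ℝ] E3} (hU : ‖U - 1‖ ≤ 1 / 4) (p : E3) :
    ∃ (M : ℕ) (z : Fin M → E3) (c : Fin M), Function.Injective z ∧ z c = p ∧
      Set.range z = {x : E3 | dist x (z c) ≤ 133 / 10 ∧ ∃ a : Fin 3 → ℤ, x = z c + latPt U fccVec a} := by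
  set S : Set E3 := {x : E3 | dist x p ≤ 133 / 10 ∧ ∃ a : Fin 3 → ℤ, x = p + latPt U fccVec a} with hS
  have hfin : S.Finite := fccBall_finite hU p
  letI : Fintype ↥S := hfin.fintype
  have hp : p ∈ S := ⟨by simp only [dist_self]; norm_num, 0, by rw [latPt_zero, add_zero]⟩
  let e : ↥S ≃ Fin (Fintype.card ↥S) := Fintype.equivFin ↥S
  refine ⟨Fintype.card ↥S, fun i => ((e.symm i : ↥S) : E3), e ⟨p, hp⟩, ?_, ?_, ?_⟩
  · exact Subtype.val_injective.comp e.symm.injective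
  · simp
  · have hzc : (fun i => ((e.symm i : ↥S) : E3)) (e ⟨p, hp⟩) = p := by simp
    rw [hzc]
    ext x
    constructor
    · rintro ⟨i, rfl⟩
      exact (e.symm i).2
    · intro hx
      exact ⟨e ⟨x, hx⟩, by simp⟩

/-! ## §2. Admissibility from four cluster-free certificates -/

/-- ★★ **ADMISSIBILITY OF A DEFORMED fcc BALL FROM PARAMETRIC CERTIFICATES** (`‖U − 1‖ ≤ 1/4`, `T = U·L_fcc`): for every injective enumeration,
(a) no site with radius-`5/2` homogeneity is `1/20`-good, (b) every site with radius-`15/2` homogeneity is `1/8`-good, (c)/(d) no site with closed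
radius-`7` homogeneity is removal- or move-unstable ⟹ `Admissible M z c`. [folklore] -/
theorem admissible_of_certificates_fcc {U : E3 →L[ℝ] E3} (hU : ‖U - 1‖ ≤ 1 / 4) {M : ℕ} {z : Fin M → E3} {c : Fin M}
    (hz : Function.Injective z)
    (hrange : Set.range z = {x : E3 | dist x (z c) ≤ 133 / 10 ∧ ∃ a : Fin 3 → ℤ, x = z c + latPt U fccVec a})
    (hbad20 : ∀ (M' : ℕ) (z' : Fin M' → E3) (j' : Fin M'),
      (∀ x : E3, dist x (z' j') < 5 / 2 → (x ∈ Set.range z' ↔ x - z' j' ∈ {v : E3 | ∃ b : Fin 3 → ℤ, v = latPt U fccVec b})) →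
      ¬GoodAtScale (1 / 20) (3 / 2) z' j')
    (hgood8 : ∀ (M' : ℕ) (z' : Fin M' → E3) (j' : Fin M'),
      (∀ x : E3, dist x (z' j') < 15 / 2 → (x ∈ Set.range z' ↔ x - z' j' ∈ {v : E3 | ∃ b : Fin 3 → ℤ, v = latPt U fccVec b})) →
      GoodAtScale (1 / 8) (3 / 2) z' j')
    (hrem : ∀ (M' : ℕ) (z' : Fin M' → E3) (j' : Fin M'), Function.Injective z' →
      (∀ x : E3, dist x (z' j') ≤ 7 → (x ∈ Set.range z' ↔ x - z' j' ∈ {v : E3 | ∃ b : Fin 3 → ℤ, v = latPt U fccVec b})) →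
      ¬RemovalUnstableCore (-(7175 / 10000)) (1 / 10000) 7 M' z' j')
    (hmove : ∀ (M' : ℕ) (z' : Fin M' → E3) (j' : Fin M'), Function.Injective z' →
      (∀ x : E3, dist x (z' j') ≤ 7 → (x ∈ Set.range z' ↔ x - z' j' ∈ {v : E3 | ∃ b : Fin 3 → ℤ, v = latPt U fccVec b})) →
      ∀ s : ℝ, 0 ≤ s → s ≤ 3 / 2 → ¬MoveUnstableCore 0 7 s M' z' j') :
    Admissible M z c := by
  refine (admissible_iff_of_fcc_range hU hrange).2 ⟨hz, ?_, ?_, ?_⟩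
  · rintro ⟨j, hj, hgood⟩
    have hjc := mem_ball.1 hj
    exact hbad20 M z j (locHom_fcc_site hrange hjc (by norm_num : (5 : ℝ) / 2 + 9 / 5 ≤ 133 / 10)) hgood
  · rintro ⟨j, hj, hEx⟩
    have hjc := mem_ball.1 hj
    unfold ExRec Collar at hEx
    obtain ⟨k, hk, hor⟩ := hEx
    have hkc : dist (z k) (z c) ≤ 63 / 10 := by
      have := dist_triangle (z k) (z j) (z c)
      linarith [mem_ball.1 hk]
    rcases hor with ⟨s, hs0, hs1, hne⟩ | hgood
    · rcases hne with hmv | hrm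
      · exact hmove M z k hz (locHom_fcc_site_closed hrange hkc (by norm_num : (7 : ℝ) + 63 / 10 ≤ 133 / 10)) s hs0 hs1 hmv
      · exact hrem M z k hz (locHom_fcc_site_closed hrange hkc (by norm_num : (7 : ℝ) + 63 / 10 ≤ 133 / 10)) hrm
    · exact hbad20 M z k (locHom_fcc_site hrange hkc (by norm_num : (5 : ℝ) / 2 + 63 / 10 ≤ 133 / 10)) hgood
  · rintro ⟨j, hj, hnot⟩
    have hjc := mem_ball.1 hj
    exact hnot (hgood8 M z j (locHom_fcc_site hrange hjc (by norm_num : (15 : ℝ) / 2 + 9 / 5 ≤ 133 / 10)))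

/-! ## §3. `(R)` from a floor number and the certificates -/

/-- ★★★ **`(R)` FROM A FLOOR NUMBER AND PARAMETRIC CERTIFICATES AT ONE fcc-TYPE REFERENCE** (`‖U − 1‖ ≤ 1/4`): the four certificates of
`admissible_of_certificates_fcc` plus the plain floor `X_fcc(U) − (L·σ₁ + B) ≤ ballAvg` on every admissible cluster ⟹ `TextureReliefBound L B`.
No cluster is exhibited: the realisation comes from `exists_realisation_fcc`. [folklore] -/
theorem textureReliefBound_of_floor_of_certificates_fcc {L B : ℝ} {U : E3 →L[ℝ] E3} (hU : ‖U - 1‖ ≤ 1 / 4)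
    (hbad20 : ∀ (M' : ℕ) (z' : Fin M' → E3) (j' : Fin M'),
      (∀ x : E3, dist x (z' j') < 5 / 2 → (x ∈ Set.range z' ↔ x - z' j' ∈ {v : E3 | ∃ b : Fin 3 → ℤ, v = latPt U fccVec b})) →
      ¬GoodAtScale (1 / 20) (3 / 2) z' j')
    (hgood8 : ∀ (M' : ℕ) (z' : Fin M' → E3) (j' : Fin M'),
      (∀ x : E3, dist x (z' j') < 15 / 2 → (x ∈ Set.range z' ↔ x - z' j' ∈ {v : E3 | ∃ b : Fin 3 → ℤ, v = latPt U fccVec b})) →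
      GoodAtScale (1 / 8) (3 / 2) z' j')
    (hrem : ∀ (M' : ℕ) (z' : Fin M' → E3) (j' : Fin M'), Function.Injective z' →
      (∀ x : E3, dist x (z' j') ≤ 7 → (x ∈ Set.range z' ↔ x - z' j' ∈ {v : E3 | ∃ b : Fin 3 → ℤ, v = latPt U fccVec b})) →
      ¬RemovalUnstableCore (-(7175 / 10000)) (1 / 10000) 7 M' z' j')
    (hmove : ∀ (M' : ℕ) (z' : Fin M' → E3) (j' : Fin M'), Function.Injective z' →
      (∀ x : E3, dist x (z' j') ≤ 7 → (x ∈ Set.range z' ↔ x - z' j' ∈ {v : E3 | ∃ b : Fin 3 → ℤ, v = latPt U fccVec b})) →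
      ∀ s : ℝ, 0 ≤ s → s ≤ 3 / 2 → ¬MoveUnstableCore 0 7 s M' z' j')
    (hfloor : ∀ (M : ℕ) (z : Fin M → E3) (c : Fin M), Admissible M z c →
      (∑ᶠ v ∈ {v : E3 | v ≠ 0 ∧ ∃ b : Fin 3 → ℤ, v = latPt U fccVec b}, effPot w₄₅ ω₄ (3 / 400) ‖v‖) / 2 - (-(7175 / 10000) + 3 / 400)
        - (L * sigmaOne + B) ≤ ballAvg (9 / 5) z (xRec M z) c) :
    TextureReliefBound L B := by
  obtain ⟨M₀, z₀, c₀, hz₀, -, hrange₀⟩ := exists_realisation_fcc hU 0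
  exact textureReliefBound_of_floor_of_realised_fcc hU (admissible_of_certificates_fcc hU hz₀ hrange₀ hbad20 hgood8 hrem hmove) hrange₀ hfloor

end Summit.AtomisticToContinuum.Crystallization.Theorems.FrustratedLawDichotomyStrainedPatchHomWitness

end
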